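import Mathlib.MeasureTheory.Constructions.BorelSpace.Order
import Mathlib.MeasureTheory.Constructions.BorelSpace.Real
import Mathlib.Topology.Order.MonotoneConvergence
import Mathlib.MeasureTheory.Function.SpecialFunctions.Basic
import Mathlib.Analysis.SpecificLimits.Basic

/-!
# Extension of bounded supermodular functions across the two faces of one coordinate (the trace construction)

Support file of the Sahi cell (`prim-sahi`, typer seat, generation 22; `--supports stmt-CriticalPhenomena-4575`).
Theorems only (no definitions, no named facts, no sorries).

Motivation (plan R5, uniformly positive versions under product reference measures with atoms): the transport of
Borel everywhere-MTP₂ versions from Lebesgue measure on `ℝ^ι` to the open unit cube (`SahiAEVersionTransport`) yields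
a version living on the OPEN cube only (`𝟙_U · (F'' ∘ logit)`), while the coordinatewise distribution functions /
randomised probability integral transforms of the next transport step land on the faces of the CLOSED cube (at the
points outside the essential range box — a null set, but "MTP₂ at every pair" includes it).  A version which is
uniformly positive everywhere therefore needs an EXTENSION across the faces; `SahiAEBoxExtension.lean` proves it by
iterating the one-coordinate step of this file:

* `incrDiff_of_supermodularOn` — supermodularity on `V ∩ {a < xᵢ < b}` gives increasing differences of the
  coordinate `i` against the rest;
* `exists_supermodular_extension_coord` — one coordinate `i`, both faces at once: if `ψ` is bounded, measurable and
  supermodular on `V ∩ {a < xᵢ < b}` for a set `V ⊆ ℝ^ι` closed under `∧`, `∨` and not constraining the coordinate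
  `i`, then some bounded measurable `ψ'` agrees with `ψ` on `{a < xᵢ < b}` and is supermodular on all of `V`.  Across
  the face `xᵢ = a` the extension is the TRACE `E(x) = limₙ [ψ(x; xᵢ := sₙ) − ψ(y₀; xᵢ := sₙ)]` (`sₙ ↓ a`), which
  exists because, by increasing differences, it is the sum of an antitone and a monotone bounded sequence (so it is
  `⨅ + ⨆`, hence Borel); ONE reparametrisation of the coordinate (`gₙ`: `sₙ` below `a`, the identity inside,
  `b − (sₙ − a)` above), monotone on any fixed pair of values for `n` large, proves the nine face/interior cases of the
  supermodular inequality at once, by passing to the limit in the inequality for the reparametrised points.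

(The closed-end / clamp case is the classical fact that composition with coordinatewise monotone maps preserves
L-superadditivity; the open-face trace seems not to be in print — presearch: none.)  No sorries, no new axioms.
-/

noncomputable section

namespace Summit.CriticalPhenomena.PercolationContinuityZ3.Theorems.SahiAEFourFunctions

open MeasureTheory Set Filter Topology Function
open scoped ENNReal NNReal

variable {ι : Type*}

/-! ### Small lattice lemmas for `Function.update` -/

section Update

variable [DecidableEq ι]

/-- Meet of two updates at the same coordinate. [folklore] -/
theorem update_inf_update (x y : ι → ℝ) (i : ι) (s t : ℝ) :
    update x i s ⊓ update y i t = update (x ⊓ y) i (s ⊓ t) := by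
  funext j
  by_cases hj : j = i
  · subst hj; simp
  · simp [update_of_ne hj]

/-- Join of two updates at the same coordinate. [folklore] -/
theorem update_sup_update (x y : ι → ℝ) (i : ι) (s t : ℝ) :
    update x i s ⊔ update y i t = update (x ⊔ y) i (s ⊔ t) := by
  funext j
  by_cases hj : j = i
  · subst hj; simp
  · simp [update_of_ne hj]

omit [DecidableEq ι] in
/-- `h (s ∧ t) + h (s ∨ t) = h s + h t` for real `s, t` (a chain is a modular lattice for every function). [folklore] -/
theorem apply_min_add_apply_max (h : ℝ → ℝ) (s t : ℝ) : h (min s t) + h (max s t) = h s + h t := by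
  rcases le_total s t with hst | hts
  · rw [min_eq_left hst, max_eq_right hst]
  · rw [min_eq_right hts, max_eq_left hts, add_comm]

omit [DecidableEq ι] in
/-- `x ↦ x ⊓ y₀` is measurable on `ℝ^ι`. [folklore] -/
theorem measurable_inf_const_pi (y₀ : ι → ℝ) : Measurable fun x : ι → ℝ => x ⊓ y₀ :=
  measurable_pi_iff.2 fun j => (measurable_pi_apply j).min measurable_const

/-- **Increasing differences** from supermodularity on `V ∩ {a < xᵢ < b}`: for `w ≤ x` in `V` and
`a < s ≤ s' < b`, `ψ(x; xᵢ := s) − ψ(w; wᵢ := s) ≤ ψ(x; xᵢ := s') − ψ(w; wᵢ := s')`. [folklore] -/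
theorem incrDiff_of_supermodularOn {V : Set (ι → ℝ)} {i : ι} {a b : ℝ} {ψ : (ι → ℝ) → ℝ}
    (hVi : ∀ x ∈ V, ∀ s, update x i s ∈ V)
    (hsm : ∀ x ∈ V, ∀ y ∈ V, a < x i → x i < b → a < y i → y i < b → ψ x + ψ y ≤ ψ (x ⊓ y) + ψ (x ⊔ y))
    {x w : ι → ℝ} (hx : x ∈ V) (hw : w ∈ V) (hwx : w ≤ x) {s s' : ℝ} (has : a < s) (hss' : s ≤ s')
    (hs'b : s' < b) :
    ψ (update x i s) - ψ (update w i s) ≤ ψ (update x i s') - ψ (update w i s') := by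
  have h := hsm (update x i s) (hVi x hx s) (update w i s') (hVi w hw s')
    (by simpa using has) (by simp only [update_self]; linarith) (by simp only [update_self]; linarith)
    (by simpa using hs'b)
  rw [update_inf_update, update_sup_update, inf_eq_right.2 hwx, sup_eq_left.2 hwx, inf_eq_left.2 hss',
    sup_eq_right.2 hss'] at h
  linarith

end Update

/-! ### One coordinate, both faces -/

section OneCoordinate

variable [DecidableEq ι]

/-- **One-coordinate two-sided extension.**  Let `V ⊆ ℝ^ι` be closed under `∧`, `∨` and under changing the `i`-th
coordinate, `y₀ ∈ V`, and let `ψ : ℝ^ι → ℝ` be measurable, `|ψ| ≤ K`, and supermodular on every pair of points of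
`V ∩ {a < xᵢ < b}` (`a < b`).  Then there is a measurable `ψ'`, `|ψ'| ≤ 4K`, with `ψ' = ψ` on `{a < xᵢ < b}` and
`ψ'(x) + ψ'(y) ≤ ψ'(x ∧ y) + ψ'(x ∨ y)` for ALL `x, y ∈ V`.  On `{xᵢ ≤ a}` the extension is the trace
`limₙ [ψ(x; xᵢ := sₙ) − ψ(y₀; xᵢ := sₙ)]`, `sₙ = a + (b − a)/(n + 2)`, and symmetrically on `{b ≤ xᵢ}`. [this work] -/
theorem exists_supermodular_extension_coord (V : Set (ι → ℝ)) (i : ι) {a b : ℝ} (hab : a < b)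
    (hVi : ∀ x ∈ V, ∀ s, update x i s ∈ V) (hVinf : ∀ x ∈ V, ∀ y ∈ V, x ⊓ y ∈ V)
    (hVsup : ∀ x ∈ V, ∀ y ∈ V, x ⊔ y ∈ V) {y₀ : ι → ℝ} (hy₀ : y₀ ∈ V)
    (ψ : (ι → ℝ) → ℝ) (hψ : Measurable ψ) {K : ℝ} (hK : ∀ x, |ψ x| ≤ K)
    (hsm : ∀ x ∈ V, ∀ y ∈ V, a < x i → x i < b → a < y i → y i < b → ψ x + ψ y ≤ ψ (x ⊓ y) + ψ (x ⊔ y)) :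
    ∃ ψ' : (ι → ℝ) → ℝ, Measurable ψ' ∧ (∀ x, |ψ' x| ≤ 4 * K) ∧ (∀ x, a < x i → x i < b → ψ' x = ψ x) ∧
      ∀ x ∈ V, ∀ y ∈ V, ψ' x + ψ' y ≤ ψ' (x ⊓ y) + ψ' (x ⊔ y) := by
  have hK0 : 0 ≤ K := (abs_nonneg _).trans (hK y₀)
  have hKψ : ∀ x, -K ≤ ψ x ∧ ψ x ≤ K := fun x => abs_le.1 (hK x)
  -- the two sequences of levels `σlo n ↓ a`, `σhi n ↑ b`
  set r : ℕ → ℝ := fun n => ((n : ℝ) + 2)⁻¹ with hr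
  have hr0 : ∀ n, 0 < r n := fun n => by positivity
  have hr2 : ∀ n, r n ≤ 2⁻¹ := fun n => by
    have : (2 : ℝ) ≤ (n : ℝ) + 2 := by have := Nat.cast_nonneg (α := ℝ) n; linarith
    exact inv_anti₀ (by norm_num) this
  have hr_anti : Antitone r := fun m n hmn => by
    have hmn' : (m : ℝ) ≤ n := by exact_mod_cast hmn
    exact inv_anti₀ (by positivity) (by linarith)
  have hr_lim : Tendsto r atTop (𝓝 0) := by
    have h := tendsto_one_div_add_atTop_nhds_zero_nat (𝕜 := ℝ)
    have h' : Tendsto (fun n : ℕ => 1 / ((↑(n + 1) : ℝ) + 1)) atTop (𝓝 0) := h.comp (tendsto_add_atTop_nat 1)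
    refine h'.congr fun n => ?_
    simp only [hr, Nat.cast_add, Nat.cast_one, one_div]
    ring_nf
  have hba : 0 < b - a := sub_pos.2 hab
  set σlo : ℕ → ℝ := fun n => a + (b - a) * r n with hσlo
  set σhi : ℕ → ℝ := fun n => b - (b - a) * r n with hσhi
  have hσlo_a : ∀ n, a < σlo n := fun n => by simp only [hσlo]; nlinarith [hr0 n]
  have hσhi_b : ∀ n, σhi n < b := fun n => by simp only [hσhi]; nlinarith [hr0 n]
  have hσlohi : ∀ n, σlo n ≤ σhi n := fun n => by simp only [hσlo, hσhi]; nlinarith [hr2 n]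
  have hσlo_b : ∀ n, σlo n < b := fun n => (hσlohi n).trans_lt (hσhi_b n)
  have hσhi_a : ∀ n, a < σhi n := fun n => (hσlo_a n).trans_le (hσlohi n)
  have hσlo_anti : Antitone σlo := fun m n hmn => by
    simp only [hσlo]; nlinarith [hr_anti hmn]
  have hσhi_mono : Monotone σhi := fun m n hmn => by
    simp only [hσhi]; nlinarith [hr_anti hmn]
  have hσlo_lim : Tendsto σlo atTop (𝓝 a) := by
    have := (hr_lim.const_mul (b - a)).const_add a
    simpa only [mul_zero, add_zero] using this
  have hσhi_lim : Tendsto σhi atTop (𝓝 b) := by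
    have := (hr_lim.const_mul (b - a)).const_sub b
    simpa only [mul_zero, sub_zero] using this
  -- the reparametrised coordinate `g n` and the normaliser `h n`
  set g : ℕ → ℝ → ℝ := fun n s => if s ≤ a then σlo n else if s < b then s else σhi n with hg
  set h : ℕ → ℝ → ℝ := fun n s =>
    if s ≤ a then ψ (update y₀ i (σlo n)) else if s < b then 0 else ψ (update y₀ i (σhi n)) with hh
  have hg_mem : ∀ n s, a < g n s ∧ g n s < b := by
    intro n s
    simp only [hg]
    split_ifs with h1 h2
    · exact ⟨hσlo_a n, hσlo_b n⟩
    · exact ⟨not_le.1 h1, h2⟩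
    · exact ⟨hσhi_a n, hσhi_b n⟩
  have hg_mono : ∀ s t : ℝ, s ≤ t → ∀ᶠ n in atTop, g n s ≤ g n t := by
    intro s t hst
    by_cases hta : t ≤ a
    · exact Eventually.of_forall fun n => by
        simp only [hg, if_pos (hst.trans hta), if_pos hta, le_rfl]
    by_cases hsa : s ≤ a
    · by_cases htb : t < b
      · -- `σlo n ≤ t` eventually
        filter_upwards [(tendsto_order.1 hσlo_lim).2 t (not_le.1 hta)] with n hn
        simp only [hg, if_pos hsa, if_neg hta, if_pos htb]
        exact hn.le
      · exact Eventually.of_forall fun n => by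
          simp only [hg, if_pos hsa, if_neg hta, if_neg htb]; exact hσlohi n
    · have hta' : ¬ t ≤ a := hta
      by_cases hsb : s < b
      · by_cases htb : t < b
        · exact Eventually.of_forall fun n => by
            simp only [hg, if_neg hsa, if_pos hsb, if_neg hta', if_pos htb]; exact hst
        · -- `s ≤ σhi n` eventually
          filter_upwards [(tendsto_order.1 hσhi_lim).1 s hsb] with n hn
          simp only [hg, if_neg hsa, if_pos hsb, if_neg hta', if_neg htb]
          exact hn.le
      · have htb : ¬ t < b := fun h' => hsb (lt_of_le_of_lt hst h')
        exact Eventually.of_forall fun n => by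
          simp only [hg, if_neg hsa, if_neg hsb, if_neg hta', if_neg htb, le_rfl]
  -- the approximants `D n x = ψ(x; xᵢ := g n xᵢ) − h n xᵢ`
  set D : ℕ → (ι → ℝ) → ℝ := fun n x => ψ (update x i (g n (x i))) - h n (x i) with hD
  -- the traces: antitone + monotone decompositions
  set Alo : ℕ → (ι → ℝ) → ℝ := fun n x => ψ (update x i (σlo n)) - ψ (update (x ⊓ y₀) i (σlo n)) with hAlo
  set Blo : ℕ → (ι → ℝ) → ℝ := fun n x => ψ (update (x ⊓ y₀) i (σlo n)) - ψ (update y₀ i (σlo n)) with hBlo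
  set Ahi : ℕ → (ι → ℝ) → ℝ := fun n x => ψ (update x i (σhi n)) - ψ (update (x ⊓ y₀) i (σhi n)) with hAhi
  set Bhi : ℕ → (ι → ℝ) → ℝ := fun n x => ψ (update (x ⊓ y₀) i (σhi n)) - ψ (update y₀ i (σhi n)) with hBhi
  set Elo : (ι → ℝ) → ℝ := fun x => (⨅ n, Alo n x) + ⨆ n, Blo n x with hElo
  set Ehi : (ι → ℝ) → ℝ := fun x => (⨆ n, Ahi n x) + ⨅ n, Bhi n x with hEhi
  have hAlo_bd : ∀ n x, |Alo n x| ≤ 2 * K := fun n x => by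
    simp only [hAlo]; have := hKψ (update x i (σlo n)); have := hKψ (update (x ⊓ y₀) i (σlo n))
    exact abs_le.2 ⟨by linarith, by linarith⟩
  have hBlo_bd : ∀ n x, |Blo n x| ≤ 2 * K := fun n x => by
    simp only [hBlo]; have := hKψ (update (x ⊓ y₀) i (σlo n)); have := hKψ (update y₀ i (σlo n))
    exact abs_le.2 ⟨by linarith, by linarith⟩
  have hAhi_bd : ∀ n x, |Ahi n x| ≤ 2 * K := fun n x => by
    simp only [hAhi]; have := hKψ (update x i (σhi n)); have := hKψ (update (x ⊓ y₀) i (σhi n))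
    exact abs_le.2 ⟨by linarith, by linarith⟩
  have hBhi_bd : ∀ n x, |Bhi n x| ≤ 2 * K := fun n x => by
    simp only [hBhi]; have := hKψ (update (x ⊓ y₀) i (σhi n)); have := hKψ (update y₀ i (σhi n))
    exact abs_le.2 ⟨by linarith, by linarith⟩
  -- bounds of the traces (valid everywhere)
  have hiInf_bd : ∀ (u : ℕ → ℝ), (∀ n, |u n| ≤ 2 * K) → |⨅ n, u n| ≤ 2 * K := by
    intro u hu
    have hbb : BddBelow (range u) := ⟨-(2 * K), by rintro _ ⟨n, rfl⟩; exact (abs_le.1 (hu n)).1⟩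
    refine abs_le.2 ⟨le_ciInf fun n => (abs_le.1 (hu n)).1, (ciInf_le hbb 0).trans (abs_le.1 (hu 0)).2⟩
  have hiSup_bd : ∀ (u : ℕ → ℝ), (∀ n, |u n| ≤ 2 * K) → |⨆ n, u n| ≤ 2 * K := by
    intro u hu
    have hba' : BddAbove (range u) := ⟨2 * K, by rintro _ ⟨n, rfl⟩; exact (abs_le.1 (hu n)).2⟩
    refine abs_le.2 ⟨(abs_le.1 (hu 0)).1.trans (le_ciSup hba' 0), ciSup_le fun n => (abs_le.1 (hu n)).2⟩
  have hElo_bd : ∀ x, |Elo x| ≤ 4 * K := fun x => by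
    have h1 := abs_le.1 (hiInf_bd (fun n => Alo n x) fun n => hAlo_bd n x)
    have h2 := abs_le.1 (hiSup_bd (fun n => Blo n x) fun n => hBlo_bd n x)
    simp only [hElo]
    exact abs_le.2 ⟨by linarith, by linarith⟩
  have hEhi_bd : ∀ x, |Ehi x| ≤ 4 * K := fun x => by
    have h1 := abs_le.1 (hiSup_bd (fun n => Ahi n x) fun n => hAhi_bd n x)
    have h2 := abs_le.1 (hiInf_bd (fun n => Bhi n x) fun n => hBhi_bd n x)
    simp only [hEhi]
    exact abs_le.2 ⟨by linarith, by linarith⟩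
  -- convergence of the traces on `V`
  have hID := fun {x w : ι → ℝ} (hx : x ∈ V) (hw : w ∈ V) (hwx : w ≤ x) {s s' : ℝ} (has : a < s) (hss' : s ≤ s')
    (hs'b : s' < b) => incrDiff_of_supermodularOn hVi hsm hx hw hwx has hss' hs'b
  have hlo_tendsto : ∀ x ∈ V, Tendsto (fun n => ψ (update x i (σlo n)) - ψ (update y₀ i (σlo n))) atTop
      (𝓝 (Elo x)) := by
    intro x hx
    have hw : x ⊓ y₀ ∈ V := hVinf x hx y₀ hy₀
    have hA : Antitone fun n => Alo n x := fun m n hmn =>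
      hID hx hw inf_le_left (hσlo_a n) (hσlo_anti hmn) (hσlo_b m)
    have hB : Monotone fun n => Blo n x := fun m n hmn => by
      have := hID hy₀ hw inf_le_right (hσlo_a n) (hσlo_anti hmn) (hσlo_b m)
      simp only [hBlo]; linarith
    have hA' := tendsto_atTop_ciInf hA ⟨-(2 * K), by rintro _ ⟨n, rfl⟩; exact (abs_le.1 (hAlo_bd n x)).1⟩
    have hB' := tendsto_atTop_ciSup hB ⟨2 * K, by rintro _ ⟨n, rfl⟩; exact (abs_le.1 (hBlo_bd n x)).2⟩
    refine (hA'.add hB').congr fun n => ?_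
    simp only [hAlo, hBlo]; ring
  have hhi_tendsto : ∀ x ∈ V, Tendsto (fun n => ψ (update x i (σhi n)) - ψ (update y₀ i (σhi n))) atTop
      (𝓝 (Ehi x)) := by
    intro x hx
    have hw : x ⊓ y₀ ∈ V := hVinf x hx y₀ hy₀
    have hA : Monotone fun n => Ahi n x := fun m n hmn =>
      hID hx hw inf_le_left (hσhi_a m) (hσhi_mono hmn) (hσhi_b n)
    have hB : Antitone fun n => Bhi n x := fun m n hmn => by
      have := hID hy₀ hw inf_le_right (hσhi_a m) (hσhi_mono hmn) (hσhi_b n)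
      simp only [hBhi]; linarith
    have hA' := tendsto_atTop_ciSup hA ⟨2 * K, by rintro _ ⟨n, rfl⟩; exact (abs_le.1 (hAhi_bd n x)).2⟩
    have hB' := tendsto_atTop_ciInf hB ⟨-(2 * K), by rintro _ ⟨n, rfl⟩; exact (abs_le.1 (hBhi_bd n x)).1⟩
    refine (hA'.add hB').congr fun n => ?_
    simp only [hAhi, hBhi]; ring
  -- the extension
  set ψ' : (ι → ℝ) → ℝ := fun x => if x i ≤ a then Elo x else if x i < b then ψ x else Ehi x with hψ'
  have hD_tendsto : ∀ x ∈ V, Tendsto (fun n => D n x) atTop (𝓝 (ψ' x)) := by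
    intro x hx
    by_cases h1 : x i ≤ a
    · have e : ∀ n, D n x = ψ (update x i (σlo n)) - ψ (update y₀ i (σlo n)) := fun n => by
        simp only [hD, hg, hh, if_pos h1]
      simp only [hψ', if_pos h1]
      exact (hlo_tendsto x hx).congr fun n => (e n).symm
    · by_cases h2 : x i < b
      · have e : ∀ n, D n x = ψ x := fun n => by
          simp only [hD, hg, hh, if_neg h1, if_pos h2, update_eq_self, sub_zero]
        simp only [hψ', if_neg h1, if_pos h2]
        exact tendsto_const_nhds.congr fun n => (e n).symm
      · have e : ∀ n, D n x = ψ (update x i (σhi n)) - ψ (update y₀ i (σhi n)) := fun n => by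
          simp only [hD, hg, hh, if_neg h1, if_neg h2]
        simp only [hψ', if_neg h1, if_neg h2]
        exact (hhi_tendsto x hx).congr fun n => (e n).symm
  -- the supermodular inequality for the approximants, eventually
  have hD_sm : ∀ x ∈ V, ∀ y ∈ V, ∀ᶠ n in atTop, D n x + D n y ≤ D n (x ⊓ y) + D n (x ⊔ y) := by
    intro x hx y hy
    have hev : ∀ᶠ n in atTop, g n ((x ⊓ y) i) = g n (x i) ⊓ g n (y i) ∧ g n ((x ⊔ y) i) = g n (x i) ⊔ g n (y i) := by
      rcases le_total (x i) (y i) with hxy | hyx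
      · filter_upwards [hg_mono _ _ hxy] with n hn
        simp only [Pi.inf_apply, Pi.sup_apply, inf_eq_left.2 hxy, sup_eq_right.2 hxy, inf_eq_left.2 hn,
          sup_eq_right.2 hn, and_self]
      · filter_upwards [hg_mono _ _ hyx] with n hn
        simp only [Pi.inf_apply, Pi.sup_apply, inf_eq_right.2 hyx, sup_eq_left.2 hyx, inf_eq_right.2 hn,
          sup_eq_left.2 hn, and_self]
    filter_upwards [hev] with n hn
    have hp := hsm (update x i (g n (x i))) (hVi x hx _) (update y i (g n (y i))) (hVi y hy _)
      (by simpa using (hg_mem n (x i)).1) (by simpa using (hg_mem n (x i)).2)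
      (by simpa using (hg_mem n (y i)).1) (by simpa using (hg_mem n (y i)).2)
    rw [update_inf_update, update_sup_update, ← hn.1, ← hn.2] at hp
    have hh' : h n (x i) + h n (y i) = h n ((x ⊓ y) i) + h n ((x ⊔ y) i) := by
      rw [Pi.inf_apply, Pi.sup_apply]
      exact (apply_min_add_apply_max (h n) (x i) (y i)).symm
    simp only [hD]
    linarith
  -- measurability
  have hmeas_upd : ∀ (c : ℝ), Measurable fun x : ι → ℝ => ψ (update x i c) := fun c =>
    hψ.comp measurable_update_left
  have hmeas_upd' : ∀ (c : ℝ), Measurable fun x : ι → ℝ => ψ (update (x ⊓ y₀) i c) := fun c =>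
    hψ.comp (measurable_update_left.comp (measurable_inf_const_pi y₀))
  have hAlo_m : ∀ n, Measurable (Alo n) := fun n => (hmeas_upd _).sub (hmeas_upd' _)
  have hBlo_m : ∀ n, Measurable (Blo n) := fun n => (hmeas_upd' _).sub measurable_const
  have hAhi_m : ∀ n, Measurable (Ahi n) := fun n => (hmeas_upd _).sub (hmeas_upd' _)
  have hBhi_m : ∀ n, Measurable (Bhi n) := fun n => (hmeas_upd' _).sub measurable_const
  have hElo_m : Measurable Elo := (Measurable.iInf hAlo_m).add (Measurable.iSup hBlo_m)
  have hEhi_m : Measurable Ehi := (Measurable.iSup hAhi_m).add (Measurable.iInf hBhi_m)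
  have hψ'_m : Measurable ψ' := by
    refine Measurable.ite (measurableSet_le (measurable_pi_apply i) measurable_const) hElo_m ?_
    exact Measurable.ite (measurableSet_lt (measurable_pi_apply i) measurable_const) hψ hEhi_m
  refine ⟨ψ', hψ'_m, fun x => ?_, fun x h1 h2 => ?_, fun x hx y hy => ?_⟩
  · -- bound
    simp only [hψ']
    split_ifs
    · exact hElo_bd x
    · exact (hK x).trans (by linarith)
    · exact hEhi_bd x
  · -- agreement inside
    simp only [hψ', if_neg (not_le.2 h1), if_pos h2]
  · -- supermodular on `V`: pass to the limit
    exact le_of_tendsto_of_tendsto ((hD_tendsto x hx).add (hD_tendsto y hy))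
      ((hD_tendsto _ (hVinf x hx y hy)).add (hD_tendsto _ (hVsup x hx y hy))) (hD_sm x hx y hy)

end OneCoordinate

end Summit.CriticalPhenomena.PercolationContinuityZ3.Theorems.SahiAEFourFunctions
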